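import Summits.ValiantsHypothesis.ValiantsHypothesis.Theses.BarrierLever
import Summits.ValiantsHypothesis.ValiantsHypothesis.Theorems.BarrierLeverLevelCollapse

/-!
# ValiantsHypothesis / BarrierLever — `Assembly` (item stmt-ValiantsHypothesis-14191)

The assembly item of route `BarrierLever`:

  `SuccinctHittingSetsForVP → DefinableEquations → ValiantsHypothesis` (`VP_ℂ ≠ VNP_ℂ`).

Pure logic on top of the landed support theorem `LevelCollapse`
(`Summit.ValiantsHypothesis.Theorems.levelCollapse_proof`, file `BarrierLeverLevelCollapse.lean`):
assume the two cruxes and, for contradiction, `¬ ValiantsHypothesis`.  `DefinableEquations` gives a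
level `a`; `LevelCollapse` (under `VP = VNP`) gives `a', n₁` such that beyond `n₁` every level-`a`
boolean sum in the `N = C(2n,n)` coefficient variables lies in `Distinguishers ℂ n a'`;
`SuccinctHittingSetsForVP` at `a'` gives `b, n₀`; `DefinableEquations` at `b` gives `n₀'` and, at
`n = n₀ + n₀' + n₁`, a nonzero boolean sum `E = boolSum H` vanishing at `coeff f` for every
`f ∈ SmallCircuits ℂ n b` — while `IsSuccinctHittingSet` supplies such an `f` with `E (coeff f) ≠ 0`.
(Forbes–Shpilka–Volk 2018, Def. 1 / Thm. 4 read backwards; no evaluation at the permanent.)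
This is the composition the route's deciding theorem `closes` performs, re-filed under `Theorems`
against the standalone `LevelCollapse` so that the item closes by name.
-/

-- `Summit.ValiantsHypothesis.ValiantsHypothesis.…` is the tree's mandated single-conjunct layout
-- (Sub = Summit), so the duplicated namespace component is intended.
set_option linter.dupNamespace false

namespace Summit.ValiantsHypothesis.ValiantsHypothesis.Theorems

open Summit.ValiantsHypothesis.ValiantsHypothesis.Theses.BarrierLever

/-- **Assembly** (item stmt-ValiantsHypothesis-14191 of route BarrierLever):
`SuccinctHittingSetsForVP → DefinableEquations → ValiantsHypothesis`.
By contradiction from `¬ ValiantsHypothesis`: `LevelCollapse` turns the level-`a` boolean-sum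
equation supplied by `DefinableEquations` into a distinguisher of level `a'`, nonzero and vanishing
on the coefficient vectors of `SmallCircuits ℂ n b` for the `b` that `SuccinctHittingSetsForVP`
attaches to `a'` — contradicting the hitting-set property at `n = n₀ + n₀' + n₁`. -/
theorem barrierLeverAssembly_proof :
    Summit.ValiantsHypothesis.ValiantsHypothesis.Theses.BarrierLever.Assembly := by
  unfold Assembly
  intro hSHS hDefEq
  classical
  refine Classical.byContradiction fun hV => ?_
  obtain ⟨a, ha⟩ := hDefEq
  obtain ⟨a', n₁, hcol⟩ := Summit.ValiantsHypothesis.Theorems.levelCollapse_proof hV a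
  obtain ⟨b, n₀, hhit⟩ := hSHS a'
  obtain ⟨n₀', hdef⟩ := ha b
  obtain ⟨q, hq, H, hHc, hHd, hne, hvan⟩ := hdef (n₀ + n₀' + n₁) (by omega)
  obtain ⟨f, hf, hfne⟩ :=
    hhit (n₀ + n₀' + n₁) (by omega) _ (hcol (n₀ + n₀' + n₁) (by omega) q hq H hHc hHd) hne
  exact hfne (hvan f hf)

end Summit.ValiantsHypothesis.ValiantsHypothesis.Theorems
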